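import Summits.CriticalPhenomena.PercolationContinuityZ3.Theorems.PercNearOneGluingNoHeavyLowerTailSunflowerGradedMergeClass

/-!
# `NoHeavyLowerTail` (crux stmt-CriticalPhenomena-4575), abstract sunflower cubic: THE CLASS 𝓛⁺ IS GRADEDLY SAFE
# (merging induction: principal leaves are merged down to single coordinates, then the log-supermodular class 𝓛 applies)

Support file (seat `prim-ineq-prove-1` gen 35; `--supports stmt-CriticalPhenomena-4575`).  No `sorry`, no named facts.
Memo: run/shared/lean/prim/prim-ineq-prove-1/FINDING-PRINCIPALCORE-prove1-g34.md §9 (rule (v″)) and FINDING-LSM-prove1-g35.md §5.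

* `LP.val` — the probability of an 𝓛⁺-core as a polynomial in the leaf products `∏_{x∈g} p x` (`real_toSet_eq_val`); hence it is
  invariant under MERGING two coordinates of one leaf (`val_eq_of_merge`).
* `LP.erase` — substituting `x := 1` in a formula (erase `x` from its leaf): support, up-set (`toSet_erase`), well-formedness, surplus.
* `LP.lsmFam_of_surplus_zero` — with single-coordinate leaves an 𝓛⁺-formula is an 𝓛-formula (log-supermodular blocker).
* **`LP.gsafe`** — every well-formed 𝓛⁺-formula defines a GRADEDLY SAFE core for every `p` with `0 < p < 1` on its support:
  induction on the surplus `Σ_leaves (|g| − 1)`; a leaf with two coordinates `e ≠ e'` is merged (`gsafe_of_merge`), and at the merged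
  parameter vectors the coordinate with probability `1` is erased (`gsafe_of_coord_one`), which lowers the surplus.  With g34's
  `gsafe_union` / `safe_inter` / `safe_union_of_gsafe` this certifies g34's rule (v″) and class S″ (e.g. `(x₁x₂ ∨ x₃x₄)x₅`, `(x₁x₂ ∨ x₃)x₄`).
-/

noncomputable section

namespace Summit.CriticalPhenomena.PercolationContinuityZ3.Theorems.SunflowerPartition

namespace SafeCalc

open MeasureTheory Finset
open Literature.Probability.LatticeModels Literature.Probability.Percolation

variable {ι : Type*} [DecidableEq ι] (p : ι → unitInterval)

namespace LP

/-! ## The probability of an 𝓛⁺-core -/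

/-- The probability of the core, as a polynomial in the leaf products. [this work] -/
def val (p : ι → unitInterval) : LP ι → ℝ
  | leaf g => ∏ x ∈ g, (p x : ℝ)
  | .and F G => F.val p * G.val p
  | orLeaf F g => F.val p + (1 - F.val p) * ∏ x ∈ g, (p x : ℝ)

/-- Up-sets of 𝓛⁺-formulas are measurable. [this work] -/
theorem measurableSet_toSet (F : LP ι) : MeasurableSet F.toSet := (determinedBy_toSet F).measurableSet_of_finset

/-- `μ(F) = val F`. [this work] -/
theorem real_toSet_eq_val : ∀ F : LP ι, F.WF → (prodBernoulli p).real F.toSet = F.val p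
  | leaf g, _ => prodBernoulli_real_subset p g
  | .and F G, h => by
    rw [toSet, prodBernoulli_real_inter_of_determinedBy_disjoint p h.2.2 (determinedBy_toSet F) (determinedBy_toSet G)
      (measurableSet_toSet F) (measurableSet_toSet G), real_toSet_eq_val F h.1, real_toSet_eq_val G h.2.1, val]
  | orLeaf F g, h => by
    have hind := prodBernoulli_real_inter_of_determinedBy_disjoint p h.2.2 (determinedBy_toSet F) (determinedBy_toSet (leaf g))
      (measurableSet_toSet F) (measurableSet_toSet (leaf g))
    have hua := measureReal_union_add_inter (μ := prodBernoulli p) (s := F.toSet) (measurableSet_toSet (leaf g))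
    simp only [toSet] at hind hua
    rw [hind, real_toSet_eq_val F h.1, prodBernoulli_real_subset] at hua
    rw [toSet, val]
    linarith

/-- `val` only sees `p` on the support. [this work] -/
theorem val_congr {p p' : ι → unitInterval} : ∀ F : LP ι, (∀ x ∈ F.supp, p' x = p x) → F.val p' = F.val p
  | leaf g, h => Finset.prod_congr rfl fun x hx => by rw [h x hx]
  | .and F G, h => by
    rw [val, val, val_congr F fun x hx => h x (mem_union_left _ hx), val_congr G fun x hx => h x (mem_union_right _ hx)]
  | orLeaf F g, h => by
    rw [val, val, val_congr F fun x hx => h x (mem_union_left _ hx),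
      Finset.prod_congr rfl fun x hx => by rw [h x (mem_union_right _ hx)]]

/-- A leaf product is invariant under a merge of two of its coordinates. [this work] -/
theorem prod_eq_of_merge {p p' : ι → unitInterval} {g : Finset ι} {e e' : ι} (he : e ∈ g) (he' : e' ∈ g) (hne : e ≠ e')
    (hoff : ∀ x, x ≠ e → x ≠ e' → p' x = p x) (hprod : (p' e : ℝ) * (p' e' : ℝ) = (p e : ℝ) * (p e' : ℝ)) :
    ∏ x ∈ g, (p' x : ℝ) = ∏ x ∈ g, (p x : ℝ) := by
  have he'' : e' ∈ g.erase e := mem_erase.2 ⟨hne.symm, he'⟩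
  rw [← mul_prod_erase g _ he, ← mul_prod_erase _ _ he'', ← mul_prod_erase g (fun x => (p x : ℝ)) he,
    ← mul_prod_erase _ (fun x => (p x : ℝ)) he'', ← mul_assoc, ← mul_assoc, hprod]
  congr 1
  refine Finset.prod_congr rfl fun x hx => ?_
  rw [mem_erase, mem_erase] at hx
  rw [hoff x hx.2.1 hx.1]

/-- Distinct leaves of a well-formed formula are disjoint. [this work] -/
theorem leaves_disjoint : ∀ F : LP ι, F.WF → ∀ g₁ ∈ F.leaves, ∀ g₂ ∈ F.leaves, g₁ ≠ g₂ → Disjoint g₁ g₂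
  | leaf g, _, g₁, h1, g₂, h2, hne => by
    rw [leaves, mem_singleton] at h1 h2; exact absurd (h1.trans h2.symm) hne
  | .and F G, h, g₁, h1, g₂, h2, hne => by
    rw [leaves, mem_union] at h1 h2
    rcases h1 with h1 | h1 <;> rcases h2 with h2 | h2
    · exact leaves_disjoint F h.1 g₁ h1 g₂ h2 hne
    · exact h.2.2.mono (leaves_subset_supp F g₁ h1) (leaves_subset_supp G g₂ h2)
    · exact (h.2.2.mono (leaves_subset_supp F g₂ h2) (leaves_subset_supp G g₁ h1)).symm
    · exact leaves_disjoint G h.2.1 g₁ h1 g₂ h2 hne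
  | orLeaf F g, h, g₁, h1, g₂, h2, hne => by
    rw [leaves, mem_insert] at h1 h2
    rcases h1 with rfl | h1 <;> rcases h2 with rfl | h2
    · exact absurd rfl hne
    · exact (h.2.2.mono (leaves_subset_supp F g₂ h2) subset_rfl).symm
    · exact h.2.2.mono (leaves_subset_supp F g₁ h1) subset_rfl
    · exact leaves_disjoint F h.1 g₁ h1 g₂ h2 hne

/-- **Merge invariance of the probability**: if `p'` agrees with `p` off `{e, e'}`, `p' e · p' e' = p e · p e'`, and `e ≠ e'` lie in one
leaf of the well-formed `F`, then `val p' F = val p F`. [this work] -/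
theorem val_eq_of_merge {p p' : ι → unitInterval} {e e' : ι} (hne : e ≠ e') (hoff : ∀ x, x ≠ e → x ≠ e' → p' x = p x)
    (hprod : (p' e : ℝ) * (p' e' : ℝ) = (p e : ℝ) * (p e' : ℝ)) :
    ∀ F : LP ι, F.WF → ∀ g₀ ∈ F.leaves, e ∈ g₀ → e' ∈ g₀ → F.val p' = F.val p
  | leaf g, _, g₀, hg₀, he, he' => by
    rw [leaves, mem_singleton] at hg₀; subst hg₀
    exact prod_eq_of_merge he he' hne hoff hprod
  | .and F G, h, g₀, hg₀, he, he' => by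
    rw [leaves, mem_union] at hg₀
    rcases hg₀ with hg₀ | hg₀
    · have hG : G.val p' = G.val p := val_congr G fun x hx => hoff x
        (fun hxe => Finset.disjoint_left.1 h.2.2 (leaves_subset_supp F g₀ hg₀ he) (hxe ▸ hx))
        (fun hxe => Finset.disjoint_left.1 h.2.2 (leaves_subset_supp F g₀ hg₀ he') (hxe ▸ hx))
      rw [val, val, val_eq_of_merge hne hoff hprod F h.1 g₀ hg₀ he he', hG]
    · have hF : F.val p' = F.val p := val_congr F fun x hx => hoff x
        (fun hxe => Finset.disjoint_right.1 h.2.2 (leaves_subset_supp G g₀ hg₀ he) (hxe ▸ hx))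
        (fun hxe => Finset.disjoint_right.1 h.2.2 (leaves_subset_supp G g₀ hg₀ he') (hxe ▸ hx))
      rw [val, val, val_eq_of_merge hne hoff hprod G h.2.1 g₀ hg₀ he he', hF]
  | orLeaf F g, h, g₀, hg₀, he, he' => by
    rw [leaves, mem_insert] at hg₀
    rcases hg₀ with rfl | hg₀
    · have hF : F.val p' = F.val p := val_congr F fun x hx => hoff x
        (fun hxe => Finset.disjoint_left.1 h.2.2 (hxe ▸ hx) he)
        (fun hxe => Finset.disjoint_left.1 h.2.2 (hxe ▸ hx) he')
      rw [val, val, hF, prod_eq_of_merge he he' hne hoff hprod]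
    · have hg : ∏ x ∈ g, ((p' x : unitInterval) : ℝ) = ∏ x ∈ g, ((p x : unitInterval) : ℝ) :=
        Finset.prod_congr rfl fun x hx => by
          rw [hoff x (fun hxe => Finset.disjoint_left.1 h.2.2 (leaves_subset_supp F g₀ hg₀ he) (hxe ▸ hx))
            (fun hxe => Finset.disjoint_left.1 h.2.2 (leaves_subset_supp F g₀ hg₀ he') (hxe ▸ hx))]
      rw [val, val, val_eq_of_merge hne hoff hprod F h.1 g₀ hg₀ he he', hg]

/-! ## Substituting `x := 1`: erasing a coordinate from its leaf -/

/-- Erase the coordinate `x` from every leaf (semantically: substitute `x := 1`). [this work] -/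
def erase (x : ι) : LP ι → LP ι
  | leaf g => leaf (g.erase x)
  | .and F G => .and (F.erase x) (G.erase x)
  | orLeaf F g => orLeaf (F.erase x) (g.erase x)

/-- Support after erasing. [this work] -/
theorem supp_erase (x : ι) : ∀ F : LP ι, (F.erase x).supp = F.supp.erase x
  | leaf g => rfl
  | .and F G => by rw [erase, supp, supp, supp_erase x F, supp_erase x G, erase_union_distrib]
  | orLeaf F g => by rw [erase, supp, supp, supp_erase x F, erase_union_distrib]

omit [DecidableEq ι] in
/-- Principal filters after erasing. [this work] -/
theorem principal_erase_iff [DecidableEq ι] (g : Finset ι) (x : ι) (ω : Set ι) :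
    (↑(g.erase x) : Set ι) ⊆ ω ↔ (↑g : Set ι) ⊆ insert x ω := by
  constructor
  · intro h y hy
    by_cases hyx : y = x
    · exact Or.inl hyx
    · exact Or.inr (h (Finset.mem_coe.2 (mem_erase.2 ⟨hyx, Finset.mem_coe.1 hy⟩)))
  · intro h y hy
    rw [Finset.mem_coe, mem_erase] at hy
    rcases h (Finset.mem_coe.2 hy.2) with h' | h'
    · exact absurd h' hy.1
    · exact h'

/-- Up-set after erasing: the section at `x` present. [this work] -/
theorem toSet_erase (x : ι) : ∀ (F : LP ι) (ω : Set ι), ω ∈ (F.erase x).toSet ↔ insert x ω ∈ F.toSet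
  | leaf g, ω => principal_erase_iff g x ω
  | .and F G, ω => by
    change ω ∈ (F.erase x).toSet ∩ (G.erase x).toSet ↔ insert x ω ∈ F.toSet ∩ G.toSet
    rw [Set.mem_inter_iff, Set.mem_inter_iff, toSet_erase x F ω, toSet_erase x G ω]
  | orLeaf F g, ω => by
    change ω ∈ (F.erase x).toSet ∪ {ω | (↑(g.erase x) : Set ι) ⊆ ω} ↔ insert x ω ∈ F.toSet ∪ {ω | (↑g : Set ι) ⊆ ω}
    rw [Set.mem_union, Set.mem_union, toSet_erase x F ω]
    exact or_congr Iff.rfl (principal_erase_iff g x ω)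

/-- Erasing a coordinate outside the support changes nothing. [this work] -/
theorem erase_of_notMem (x : ι) : ∀ F : LP ι, x ∉ F.supp → F.erase x = F
  | leaf g, h => by rw [erase, Finset.erase_eq_of_notMem (show x ∉ g from h)]
  | .and F G, h => by
    rw [supp, mem_union, not_or] at h
    rw [erase, erase_of_notMem x F h.1, erase_of_notMem x G h.2]
  | orLeaf F g, h => by
    rw [supp, mem_union, not_or] at h
    rw [erase, erase_of_notMem x F h.1, Finset.erase_eq_of_notMem h.2]

/-- The surplus `Σ_leaves (|g| − 1)`: the number of merges needed to reach single-coordinate leaves. [this work] -/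
def surplus : LP ι → ℕ
  | leaf g => g.card - 1
  | .and F G => F.surplus + G.surplus
  | orLeaf F g => F.surplus + (g.card - 1)

/-- Erasing a coordinate of a leaf with at least two coordinates keeps the formula well formed and lowers the surplus. [this work] -/
theorem wf_erase_and_surplus : ∀ F : LP ι, F.WF → ∀ g₀ ∈ F.leaves, ∀ x ∈ g₀, 2 ≤ g₀.card →
    (F.erase x).WF ∧ (F.erase x).surplus < F.surplus
  | leaf g, _, g₀, hg₀, x, hx, hcard => by
    rw [leaves, mem_singleton] at hg₀; subst hg₀
    refine ⟨?_, ?_⟩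
    · change (g₀.erase x).Nonempty
      rw [← card_pos, card_erase_of_mem hx]; omega
    · change (g₀.erase x).card - 1 < g₀.card - 1
      rw [card_erase_of_mem hx]; omega
  | .and F G, h, g₀, hg₀, x, hx, hcard => by
    rw [leaves, mem_union] at hg₀
    rcases hg₀ with hg₀ | hg₀
    · have hxF : x ∈ F.supp := leaves_subset_supp F g₀ hg₀ hx
      have hxG : x ∉ G.supp := fun h' => Finset.disjoint_left.1 h.2.2 hxF h'
      obtain ⟨hwf, hs⟩ := wf_erase_and_surplus F h.1 g₀ hg₀ x hx hcard
      refine ⟨⟨hwf, by rw [erase_of_notMem x G hxG]; exact h.2.1, ?_⟩, ?_⟩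
      · rw [supp_erase, erase_of_notMem x G hxG]
        exact h.2.2.mono (erase_subset _ _) subset_rfl
      · change (F.erase x).surplus + (G.erase x).surplus < F.surplus + G.surplus
        rw [erase_of_notMem x G hxG]; omega
    · have hxG : x ∈ G.supp := leaves_subset_supp G g₀ hg₀ hx
      have hxF : x ∉ F.supp := fun h' => Finset.disjoint_left.1 h.2.2 h' hxG
      obtain ⟨hwf, hs⟩ := wf_erase_and_surplus G h.2.1 g₀ hg₀ x hx hcard
      refine ⟨⟨by rw [erase_of_notMem x F hxF]; exact h.1, hwf, ?_⟩, ?_⟩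
      · rw [erase_of_notMem x F hxF, supp_erase]
        exact h.2.2.mono subset_rfl (erase_subset _ _)
      · change (F.erase x).surplus + (G.erase x).surplus < F.surplus + G.surplus
        rw [erase_of_notMem x F hxF]; omega
  | orLeaf F g, h, g₀, hg₀, x, hx, hcard => by
    rw [leaves, mem_insert] at hg₀
    rcases hg₀ with rfl | hg₀
    · have hxF : x ∉ F.supp := fun h' => Finset.disjoint_left.1 h.2.2 h' hx
      refine ⟨⟨by rw [erase_of_notMem x F hxF]; exact h.1, ?_, ?_⟩, ?_⟩
      · rw [← card_pos, card_erase_of_mem hx]; omega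
      · rw [erase_of_notMem x F hxF]
        exact h.2.2.mono subset_rfl (erase_subset _ _)
      · change (F.erase x).surplus + ((g₀.erase x).card - 1) < F.surplus + (g₀.card - 1)
        rw [erase_of_notMem x F hxF, card_erase_of_mem hx]; omega
    · have hxF : x ∈ F.supp := leaves_subset_supp F g₀ hg₀ hx
      have hxg : x ∉ g := fun h' => Finset.disjoint_left.1 h.2.2 hxF h'
      obtain ⟨hwf, hs⟩ := wf_erase_and_surplus F h.1 g₀ hg₀ x hx hcard
      refine ⟨⟨hwf, ?_, ?_⟩, ?_⟩
      · rw [Finset.erase_eq_of_notMem hxg]; exact h.2.1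
      · rw [supp_erase, Finset.erase_eq_of_notMem hxg]
        exact h.2.2.mono (erase_subset _ _) subset_rfl
      · change (F.erase x).surplus + ((g.erase x).card - 1) < F.surplus + (g.card - 1)
        rw [Finset.erase_eq_of_notMem hxg]; omega

/-- A formula with positive surplus has a leaf with two coordinates. [this work] -/
theorem exists_big_leaf : ∀ F : LP ι, 0 < F.surplus → ∃ g ∈ F.leaves, 2 ≤ g.card
  | leaf g, h => ⟨g, mem_singleton_self _, by change 0 < g.card - 1 at h; omega⟩
  | .and F G, h => by
    change 0 < F.surplus + G.surplus at h
    by_cases hF : 0 < F.surplus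
    · obtain ⟨g, hg, hc⟩ := exists_big_leaf F hF
      exact ⟨g, mem_union_left _ hg, hc⟩
    · obtain ⟨g, hg, hc⟩ := exists_big_leaf G (by omega)
      exact ⟨g, mem_union_right _ hg, hc⟩
  | orLeaf F g, h => by
    change 0 < F.surplus + (g.card - 1) at h
    by_cases hF : 0 < F.surplus
    · obtain ⟨g', hg, hc⟩ := exists_big_leaf F hF
      exact ⟨g', mem_insert_of_mem hg, hc⟩
    · exact ⟨g, mem_insert_self _ _, by omega⟩

/-! ## Base case: single-coordinate leaves -/

/-- With single-coordinate leaves (surplus `0`) the blocker is log-supermodular (the class 𝓛). [this work] -/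
theorem lsmFam_of_surplus_zero : ∀ F : LP ι, F.WF → F.surplus = 0 → LSMFam p F.supp F.toSet F.fam
  | leaf g, h, h0 => by
    change g.card - 1 = 0 at h0
    have hg : g.Nonempty := h
    have hcard : g.card = 1 := by have := card_pos.2 hg; omega
    obtain ⟨x, rfl⟩ := card_eq_one.1 hcard
    have h1 : (leaf {x} : LP ι).toSet = {ω | x ∈ ω} := by
      ext ω; change (↑({x} : Finset ι) : Set ι) ⊆ ω ↔ x ∈ ω
      rw [Finset.coe_singleton, Set.singleton_subset_iff]
    have h2 : (leaf {x} : LP ι).fam = ({{x}} : Finset (Finset ι)) := by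
      change ({x} : Finset ι).image (fun y => ({y} : Finset ι)) = {{x}}; rw [image_singleton]
    rw [h1, h2]
    exact lsmFam_leaf p x
  | .and F G, h, h0 => by
    change F.surplus + G.surplus = 0 at h0
    exact lsmFam_and p h.2.2 (determinedBy_toSet F) (determinedBy_toSet G) (lsmFam_of_surplus_zero F h.1 (by omega))
      (lsmFam_of_surplus_zero G h.2.1 (by omega))
  | orLeaf F g, h, h0 => by
    change F.surplus + (g.card - 1) = 0 at h0
    have hcard : g.card = 1 := by have := card_pos.2 h.2.1; omega
    obtain ⟨x, rfl⟩ := card_eq_one.1 hcard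
    have hx : x ∉ F.supp := fun hx => Finset.disjoint_left.1 h.2.2 hx (mem_singleton_self x)
    have h1 : (orLeaf F {x} : LP ι).toSet = F.toSet ∪ {ω | x ∈ ω} := by
      ext ω
      change ω ∈ F.toSet ∪ {ω | (↑({x} : Finset ι) : Set ι) ⊆ ω} ↔ ω ∈ F.toSet ∪ {ω | x ∈ ω}
      rw [Finset.coe_singleton]
      simp only [Set.mem_union, Set.mem_setOf_eq, Set.singleton_subset_iff]
    have h2 : (orLeaf F {x} : LP ι).fam = F.fam.image fun C => C ∪ {x} := by
      change (F.fam ×ˢ ({x} : Finset ι)).image (fun q => q.1 ∪ {q.2}) = F.fam.image fun C => C ∪ {x}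
      ext C
      simp only [mem_image, mem_product, mem_singleton, Prod.exists]
      constructor
      · rintro ⟨C', y, ⟨hC', rfl⟩, rfl⟩; exact ⟨C', hC', rfl⟩
      · rintro ⟨C', hC', rfl⟩; exact ⟨C', x, ⟨hC', rfl⟩, rfl⟩
    have h3 : (orLeaf F {x} : LP ι).supp = F.supp ∪ {x} := rfl
    rw [h1, h2, h3]
    exact lsmFam_orLeaf p hx (lsmFam_of_surplus_zero F h.1 (by omega))

/-! ## The merging induction -/

/-- Graded safety of 𝓛⁺-formulas, by induction on the surplus. [this work] -/
theorem gsafe_aux [Fintype ι] : ∀ (s : ℕ) (F : LP ι), F.WF → F.surplus ≤ s →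
    ∀ p : ι → unitInterval, (∀ x ∈ F.supp, 0 < (p x : ℝ) ∧ (p x : ℝ) < 1) → GSafe p F.supp F.toSet := by
  intro s
  induction s with
  | zero =>
    intro F hF hs p _
    exact gsafe_of_lsmFam p (determinedBy_toSet F) (isUpperSet_toSet F) (lsmFam_of_surplus_zero p F hF (by omega))
  | succ s ih =>
    intro F hF hs p hp
    by_cases hs' : F.surplus ≤ s
    · exact ih F hF hs' p hp
    obtain ⟨g₀, hg₀, hcard⟩ := exists_big_leaf F (by omega)
    obtain ⟨e, he, e', he', hne⟩ := one_lt_card.1 (by omega : 1 < g₀.card)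
    have heS : e ∈ F.supp := leaves_subset_supp F g₀ hg₀ he
    have he'S : e' ∈ F.supp := leaves_subset_supp F g₀ hg₀ he'
    have hpe := hp e heS
    have hpe' := hp e' he'S
    have hsib := fam_sibling F hF g₀ hg₀ e e' he he' hne
    -- the two merged parameter vectors, and the erased formulas
    have hprodmem : (0 : ℝ) < (p e : ℝ) * (p e' : ℝ) ∧ (p e : ℝ) * (p e' : ℝ) < 1 :=
      ⟨mul_pos hpe.1 hpe'.1, by nlinarith [hpe.1, hpe.2, hpe'.1, hpe'.2]⟩
    -- erase e' at mergeL, erase e at mergeR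
    have hL : GSafe (mergeL p e e') F.supp F.toSet := by
      obtain ⟨hwf, hsur⟩ := wf_erase_and_surplus F hF g₀ hg₀ e' he' hcard
      have hq : ∀ x ∈ (F.erase e').supp, 0 < ((mergeL p e e' x : unitInterval) : ℝ) ∧ ((mergeL p e e' x : unitInterval) : ℝ) < 1 := by
        intro x hx
        rw [supp_erase, mem_erase] at hx
        rw [coe_mergeL, Function.update_of_ne hx.1]
        by_cases hxe : x = e
        · subst hxe; rw [Function.update_self]; exact hprodmem
        · rw [Function.update_of_ne hxe]; exact hp x hx.2
      have hrec := ih (F.erase e') hwf (by omega) (mergeL p e e') hq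
      rw [supp_erase] at hrec
      refine gsafe_of_coord_one (mergeL p e e') F.supp he'S ?_ (determinedBy_toSet F) ?_ (toSet_erase e' F) hrec
      · rw [coe_mergeL, Function.update_self]
      · have := determinedBy_toSet (F.erase e'); rwa [supp_erase] at this
    have hR : GSafe (mergeR p e e') F.supp F.toSet := by
      obtain ⟨hwf, hsur⟩ := wf_erase_and_surplus F hF g₀ hg₀ e he hcard
      have hq : ∀ x ∈ (F.erase e).supp, 0 < ((mergeR p e e' x : unitInterval) : ℝ) ∧ ((mergeR p e e' x : unitInterval) : ℝ) < 1 := by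
        intro x hx
        rw [supp_erase, mem_erase] at hx
        rw [coe_mergeR]
        by_cases hxe' : x = e'
        · subst hxe'; rw [Function.update_self]; exact hprodmem
        · rw [Function.update_of_ne hxe', Function.update_of_ne hx.1]; exact hp x hx.2
      have hrec := ih (F.erase e) hwf (by omega) (mergeR p e e') hq
      rw [supp_erase] at hrec
      refine gsafe_of_coord_one (mergeR p e e') F.supp heS ?_ (determinedBy_toSet F) ?_ (toSet_erase e F) hrec
      · rw [coe_mergeR, Function.update_of_ne hne, Function.update_self]
      · have := determinedBy_toSet (F.erase e); rwa [supp_erase] at this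
    -- μ is invariant under both merges
    have hoffL : ∀ x, x ≠ e → x ≠ e' → mergeL p e e' x = p x := by
      intro x hx hx'; unfold mergeL; rw [Function.update_of_ne hx', Function.update_of_ne hx]
    have hoffR : ∀ x, x ≠ e → x ≠ e' → mergeR p e e' x = p x := by
      intro x hx hx'; unfold mergeR; rw [Function.update_of_ne hx', Function.update_of_ne hx]
    have hprodL : ((mergeL p e e' e : unitInterval) : ℝ) * (mergeL p e e' e' : ℝ) = (p e : ℝ) * (p e' : ℝ) := by
      rw [coe_mergeL, coe_mergeL, Function.update_self, Function.update_of_ne hne, Function.update_self, mul_one]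
    have hprodR : ((mergeR p e e' e : unitInterval) : ℝ) * (mergeR p e e' e' : ℝ) = (p e : ℝ) * (p e' : ℝ) := by
      rw [coe_mergeR, coe_mergeR, Function.update_self, Function.update_of_ne hne, Function.update_self, one_mul]
    have hμL : (prodBernoulli (mergeL p e e')).real F.toSet ≤ (prodBernoulli p).real F.toSet := by
      rw [real_toSet_eq_val _ F hF, real_toSet_eq_val _ F hF, val_eq_of_merge hne hoffL hprodL F hF g₀ hg₀ he he']
    have hμR : (prodBernoulli (mergeR p e e')).real F.toSet ≤ (prodBernoulli p).real F.toSet := by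
      rw [real_toSet_eq_val _ F hF, real_toSet_eq_val _ F hF, val_eq_of_merge hne hoffR hprodR F hF g₀ hg₀ he he']
    exact gsafe_of_merge p F.supp (isUpperSet_toSet F) heS he'S hne hpe.1 hpe.2 hpe'.1 F.fam (fam_bad F hF)
      (fam_cover F hF) hsib hL hR hμL hμR

/-- **Every well-formed 𝓛⁺-formula defines a GRADEDLY SAFE core** (for `0 < p < 1` on its support): Theorems A–C + the merging rule.
[this work] -/
theorem gsafe [Fintype ι] (F : LP ι) (hF : F.WF) (hp : ∀ x ∈ F.supp, 0 < (p x : ℝ) ∧ (p x : ℝ) < 1) : GSafe p F.supp F.toSet :=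
  gsafe_aux F.surplus F hF le_rfl p hp

/-- … hence a SAFE one. [this work] -/
theorem safe [Fintype ι] (F : LP ι) (hF : F.WF) (hp : ∀ x ∈ F.supp, 0 < (p x : ℝ) ∧ (p x : ℝ) < 1) : Safe p F.toSet :=
  safe_of_gsafe p F.supp (determinedBy_toSet F) (isUpperSet_toSet F) (gsafe p F hF hp)

end LP

/-! ## Example: `(x₁x₂ ∨ x₃x₄) ∧ x₅`, gradedly safe by merging (not log-supermodular) -/

/-- `(x₁x₂ ∨ x₃x₄) ∧ x₅` as an 𝓛⁺-formula. [this work] -/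
def exampleLP (x₁ x₂ x₃ x₄ x₅ : ι) : LP ι := LP.and (LP.orLeaf (LP.leaf {x₁, x₂}) {x₃, x₄}) (LP.leaf {x₅})

/-- **`(x₁x₂ ∨ x₃x₄) ∧ x₅` is gradedly safe** (for `0 < p < 1`; the blocks `{x₁,x₂}`, `{x₃,x₄}`, `{x₅}` pairwise disjoint) — the smallest
read-once core that is gradedly safe only via merging. [this work] -/
theorem gsafe_exampleLP [Fintype ι] (x₁ x₂ x₃ x₄ x₅ : ι) (h13 : x₁ ≠ x₃) (h14 : x₁ ≠ x₄) (h15 : x₁ ≠ x₅)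
    (h23 : x₂ ≠ x₃) (h24 : x₂ ≠ x₄) (h25 : x₂ ≠ x₅) (h35 : x₃ ≠ x₅) (h45 : x₄ ≠ x₅)
    (hp : ∀ x ∈ (exampleLP x₁ x₂ x₃ x₄ x₅).supp, 0 < (p x : ℝ) ∧ (p x : ℝ) < 1) :
    GSafe p (exampleLP x₁ x₂ x₃ x₄ x₅).supp (exampleLP x₁ x₂ x₃ x₄ x₅).toSet := by
  refine LP.gsafe p _ ⟨⟨⟨x₁, mem_insert_self _ _⟩, ⟨x₃, mem_insert_self _ _⟩, ?_⟩, ⟨x₅, mem_singleton_self _⟩, ?_⟩ hp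
  · change Disjoint ({x₁, x₂} : Finset ι) {x₃, x₄}
    rw [Finset.disjoint_insert_left, Finset.disjoint_singleton_left]
    simp only [mem_insert, mem_singleton, not_or]
    exact ⟨⟨h13, h14⟩, h23, h24⟩
  · change Disjoint (({x₁, x₂} : Finset ι) ∪ {x₃, x₄}) {x₅}
    rw [Finset.disjoint_singleton_right]
    simp only [mem_union, mem_insert, mem_singleton, not_or]
    exact ⟨⟨h15.symm, h25.symm⟩, h35.symm, h45.symm⟩

end SafeCalc

end Summit.CriticalPhenomena.PercolationContinuityZ3.Theorems.SunflowerPartition
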